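import Summits.Schanuel.Schanuel.Theorems.ZilberEacParamFibreCurveGrowthGap
import HarnessLib

/-!
# Polynomially parametrised base curves, XLII: growth of `Re (c R^e + D)` along points with
# `Re R(t_j) = μ log ‖t_j‖ + O(1)`, `μ ≠ 0` — the TILTED EDGE below the Puiseux gap

HONEST FRAMING.  Cell `pub-schanuel` (Zilber's Exponential-Algebraic Closedness, case ladder;
host summit Schanuel), seat 2, gen 21.  The analytic half of the tilted-edge theorem (file XLIII),
complementary to the gap lemma of file XXXIX.  Let `R ∈ ℂ[t]` have degree `d ≥ 2` and leading
coefficient `a`; `c ≠ 0`, `e ≥ 2` with VANISHING PHASE `Re(c i^e) = 0`; `D ∈ ℂ[t]` with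
`deg D ≤ d(e-1)` (NO gap); `‖t_j‖ → ∞` and `|Re R(t_j) - μ log ‖t_j‖| ≤ B` with `μ ≠ 0` (the value
datum of file XXXVIII along a zero sequence attached to a TILTED Newton edge of slope `μ`).  Then
`|Re G(t_j)| / log(2 + ‖G(t_j)‖) → ∞` for `G = c R^e + D` (`tendsto_growth_eval_of_tilt`).
Mechanism: `w = R(t_j) = x + iy`, `|x| = |μ| log ‖t_j‖ + O(1) → ∞` but `= o(‖w‖)`; second-order
Taylor at `iy` (`norm_pow_sub_pow_sub_mul_le`): `c w^e = c (iy)^e + e c (iy)^{e-1} x + O(‖w‖^{e-2} x²)`,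
the first term has real part `0`, the second has real part `e r x y^{e-1}` with
`r = Re(c i^{e-1}) = ±‖c‖` (because `c i^e ∈ iℝ`), and `|y| ≥ ‖w‖/2`; so
`|Re G(t_j)| ≥ ‖w‖^{e-1} (κ₁ |μ| log ‖t_j‖ - K₀) ≍ ‖t_j‖^{d(e-1)} log ‖t_j‖`, beating `D = O(‖t‖^{d(e-1)})`
by the logarithm, while `log(2 + ‖G(t_j)‖) = O(log ‖t_j‖)`.  (For `e = 1` the statement is false —
and void: `deg D ≤ 0` is a line base.)  Mantova–Masser's question is OPEN in general (PLMS 2024 §1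
p. 5); NOT Schanuel's conjecture (neither used nor implied; EAC ⇏ SC); `EC(3,2)` stays OPEN.
-/

noncomputable section

open Filter Topology Metric Set Complex Polynomial
open Literature.ModelTheory.Zilber
open Literature.Geometry.Symplectic.RotationBranch (norm_pow_sub_pow_le)

set_option linter.dupNamespace false

namespace Summit.Schanuel.Schanuel.Theorems

/-! ## Part A. Elementary estimates -/

/-- If `Re(c i^{k+2}) = 0` then `c i^{k+1}` is real with `|Re(c i^{k+1})| = ‖c‖`. -/
theorem abs_re_mul_I_pow_pred_of_phase {c : ℂ} {k : ℕ} (hph : (c * I ^ (k + 2)).re = 0) :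
    (c * I ^ (k + 1)).im = 0 ∧ |(c * I ^ (k + 1)).re| = ‖c‖ := by
  have him : (c * I ^ (k + 1)).im = 0 := by
    have e1 : c * I ^ (k + 2) = (c * I ^ (k + 1)) * I := by ring
    rw [e1, Complex.mul_I_re, neg_eq_zero] at hph
    exact hph
  refine ⟨him, ?_⟩
  have e2 : c * I ^ (k + 1) = ((c * I ^ (k + 1)).re : ℂ) := by
    apply Complex.ext <;> simp [him]
  have h := congrArg (fun z : ℂ => ‖z‖) e2
  simp only [norm_mul, norm_pow, Complex.norm_I, one_pow, mul_one, Complex.norm_real,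
    Real.norm_eq_abs] at h
  exact h.symm

/-- **Second-order Taylor of `Re(c w^{k+2})` at `i Im w` under the vanishing phase**:
`|Re(c w^{k+2}) - (k+2) (Re w) (Im w)^{k+1} Re(c i^{k+1})| ≤ ‖c‖ (k+2)² ‖w‖^k (Re w)²`. (new) -/
theorem abs_re_mul_pow_sub_taylor_le {c : ℂ} {k : ℕ} (hph : (c * I ^ (k + 2)).re = 0) (w : ℂ) :
    |(c * w ^ (k + 2)).re - ((k + 2 : ℕ) : ℝ) * w.re * w.im ^ (k + 1) * (c * I ^ (k + 1)).re| ≤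
      ‖c‖ * ((k + 2 : ℕ) : ℝ) ^ 2 * ‖w‖ ^ k * w.re ^ 2 := by
  set w' : ℂ := (w.im : ℂ) * I with hw'_def
  have hnw' : ‖w'‖ ≤ ‖w‖ := by
    rw [hw'_def, norm_mul, Complex.norm_I, mul_one, Complex.norm_real, Real.norm_eq_abs]
    exact Complex.abs_im_le_norm w
  have hdiff : w - w' = (w.re : ℂ) := by apply Complex.ext <;> simp [hw'_def]
  have hT := norm_pow_sub_pow_sub_mul_le (le_refl ‖w‖) hnw' k
  rw [hdiff, Complex.norm_real, Real.norm_eq_abs, sq_abs] at hT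
  set T : ℂ := w ^ (k + 2) - w' ^ (k + 2) - ((k + 2 : ℕ) : ℂ) * w' ^ (k + 1) * (w.re : ℂ)
    with hT_def
  have hre0 : (c * w' ^ (k + 2)).re = 0 := by
    have e1 : c * w' ^ (k + 2) = ((w.im ^ (k + 2) : ℝ) : ℂ) * (c * I ^ (k + 2)) := by
      rw [hw'_def, mul_pow]; push_cast; ring
    rw [e1, Complex.re_ofReal_mul, hph, mul_zero]
  have hre1 : (c * (((k + 2 : ℕ) : ℂ) * w' ^ (k + 1) * (w.re : ℂ))).re =
      ((k + 2 : ℕ) : ℝ) * w.re * w.im ^ (k + 1) * (c * I ^ (k + 1)).re := by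
    have e1 : c * (((k + 2 : ℕ) : ℂ) * w' ^ (k + 1) * (w.re : ℂ)) =
        (((((k + 2 : ℕ) : ℝ) * w.re * w.im ^ (k + 1)) : ℝ) : ℂ) * (c * I ^ (k + 1)) := by
      rw [hw'_def, mul_pow]; push_cast; ring
    rw [e1, Complex.re_ofReal_mul]
  have hdec : (c * w ^ (k + 2)).re - ((k + 2 : ℕ) : ℝ) * w.re * w.im ^ (k + 1) * (c * I ^ (k + 1)).re
      = (c * T).re := by
    have e1 : c * w ^ (k + 2) =
        c * w' ^ (k + 2) + c * (((k + 2 : ℕ) : ℂ) * w' ^ (k + 1) * (w.re : ℂ)) + c * T := by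
      rw [hT_def]; ring
    rw [e1, Complex.add_re, Complex.add_re, hre0, hre1]; ring
  rw [hdec]
  calc |(c * T).re| ≤ ‖c * T‖ := Complex.abs_re_le_norm _
    _ = ‖c‖ * ‖T‖ := norm_mul _ _
    _ ≤ ‖c‖ * (((k + 2 : ℕ) : ℝ) ^ 2 * ‖w‖ ^ k * w.re ^ 2) :=
        mul_le_mul_of_nonneg_left hT (norm_nonneg c)
    _ = ‖c‖ * ((k + 2 : ℕ) : ℝ) ^ 2 * ‖w‖ ^ k * w.re ^ 2 := by ring

/-- Lower bound for a polynomial along large arguments: `‖R(t)‖ ≥ (‖a‖/2) ‖t‖^d` once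
`‖t‖ ≥ 1` and `2 Σ|ℓ_i| ≤ ‖a‖ ‖t‖` (`a = lc(R)`, `ℓ = R - a X^d`, `d ≥ 1`). -/
theorem norm_eval_ge_half_lead (R : Polynomial ℂ) (hd : 1 ≤ R.natDegree) {t : ℂ} (ht1 : 1 ≤ ‖t‖)
    (ht2 : 2 * coeffNormSum R.eraseLead ≤ ‖R.leadingCoeff‖ * ‖t‖) :
    ‖R.leadingCoeff‖ / 2 * ‖t‖ ^ R.natDegree ≤ ‖R.eval t‖ := by
  obtain ⟨d', hd'⟩ : ∃ d', R.natDegree = d' + 1 := ⟨R.natDegree - 1, by omega⟩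
  have hℓdeg : R.eraseLead.natDegree ≤ d' := by
    have := Polynomial.eraseLead_natDegree_le R; omega
  have hℓ : ‖R.eraseLead.eval t‖ ≤ coeffNormSum R.eraseLead * ‖t‖ ^ d' :=
    norm_eval_le_of_natDegree_le R.eraseLead ht1 le_rfl hℓdeg
  rw [eval_eq_eraseLead_add R t, hd']
  have hmain : ‖R.leadingCoeff * t ^ (d' + 1)‖ = ‖R.leadingCoeff‖ * ‖t‖ ^ (d' + 1) := by
    rw [norm_mul, norm_pow]
  have htri : ‖R.leadingCoeff * t ^ (d' + 1)‖ - ‖R.eraseLead.eval t‖ ≤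
      ‖R.eraseLead.eval t + R.leadingCoeff * t ^ (d' + 1)‖ := by
    have := norm_add_le (R.eraseLead.eval t + R.leadingCoeff * t ^ (d' + 1))
      (-(R.eraseLead.eval t))
    have e : R.eraseLead.eval t + R.leadingCoeff * t ^ (d' + 1) + -(R.eraseLead.eval t) =
        R.leadingCoeff * t ^ (d' + 1) := by ring
    rw [e, norm_neg] at this
    linarith
  have hpow : 0 ≤ ‖t‖ ^ d' := pow_nonneg (norm_nonneg _) _
  have hℓ' : coeffNormSum R.eraseLead * ‖t‖ ^ d' ≤ ‖R.leadingCoeff‖ / 2 * ‖t‖ ^ (d' + 1) := by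
    calc coeffNormSum R.eraseLead * ‖t‖ ^ d' ≤ (‖R.leadingCoeff‖ * ‖t‖ / 2) * ‖t‖ ^ d' :=
          mul_le_mul_of_nonneg_right (by linarith) hpow
      _ = ‖R.leadingCoeff‖ / 2 * ‖t‖ ^ (d' + 1) := by ring
  rw [hmain] at htri
  linarith

/-- `log(2 + ‖G(t)‖) ≤ 2 (deg G + 2) log ‖t‖` once `‖t‖ ≥ 2 + Σ|G_i| + 1`. (new) -/
theorem log_two_add_norm_eval_le (G : Polynomial ℂ) {t : ℂ} (ht1 : 1 ≤ ‖t‖)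
    (ht2 : Real.log (2 + (coeffNormSum G + 1)) ≤ Real.log ‖t‖) :
    Real.log (2 + ‖G.eval t‖) ≤ 2 * ((G.natDegree + 2 : ℕ) : ℝ) * Real.log ‖t‖ := by
  obtain ⟨C₁, hC₁⟩ : ∃ C₁ : ℝ, C₁ = coeffNormSum G + 1 := ⟨_, rfl⟩
  rw [← hC₁] at ht2
  have hC₁1 : 1 ≤ C₁ := by have := coeffNormSum_nonneg G; rw [hC₁]; linarith
  have hs0 : (0 : ℝ) ≤ ‖t‖ := norm_nonneg _
  have hGup : ‖G.eval t‖ ≤ C₁ * ‖t‖ ^ (G.natDegree + 2) := by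
    calc ‖G.eval t‖ ≤ coeffNormSum G * ‖t‖ ^ (G.natDegree + 2) :=
          norm_eval_le_of_natDegree_le G ht1 le_rfl (by omega)
      _ ≤ C₁ * ‖t‖ ^ (G.natDegree + 2) :=
          mul_le_mul_of_nonneg_right (by rw [hC₁]; linarith) (by positivity)
  have h1' : Real.log (2 + ‖G.eval t‖) ≤
      ((G.natDegree + 2 : ℕ) : ℝ) * Real.log (2 + C₁ * ‖t‖) := by
    rw [← Real.log_pow]
    refine Real.log_le_log (by linarith only [norm_nonneg (G.eval t)]) ?_
    calc 2 + ‖G.eval t‖ ≤ 2 + C₁ * ‖t‖ ^ (G.natDegree + 2) := by linarith only [hGup]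
      _ ≤ (2 + C₁ * ‖t‖) ^ (G.natDegree + 2) := two_add_mul_pow_le_pow hC₁1 hs0 G.natDegree
  have hCs : 0 ≤ C₁ * ‖t‖ := by positivity
  have h2' : Real.log (2 + C₁ * ‖t‖) ≤ Real.log (2 + C₁) + Real.log ‖t‖ := by
    rw [← Real.log_mul (by positivity) (by positivity)]
    exact Real.log_le_log (by positivity) (by nlinarith)
  have hNpos : (0 : ℝ) ≤ ((G.natDegree + 2 : ℕ) : ℝ) := by positivity
  calc Real.log (2 + ‖G.eval t‖) ≤ ((G.natDegree + 2 : ℕ) : ℝ) * Real.log (2 + C₁ * ‖t‖) := h1'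
    _ ≤ ((G.natDegree + 2 : ℕ) : ℝ) * (Real.log (2 + C₁) + Real.log ‖t‖) :=
        mul_le_mul_of_nonneg_left h2' hNpos
    _ ≤ ((G.natDegree + 2 : ℕ) : ℝ) * (Real.log ‖t‖ + Real.log ‖t‖) :=
        mul_le_mul_of_nonneg_left (by linarith) hNpos
    _ = 2 * ((G.natDegree + 2 : ℕ) : ℝ) * Real.log ‖t‖ := by ring

/-! ## Part B. The pointwise lower bound along a tilted edge -/

/-- **Pointwise lower bound** for `|Re (c R^{k+2} + D)(t)|` when `Re R(t) = μ log ‖t‖ + O(1)`,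
`μ ≠ 0`, `Re(c i^{k+2}) = 0`, `deg D ≤ d(k+1)`, for `‖t‖` beyond explicit thresholds. (new) -/
theorem tilt_re_lower_bound (R : Polynomial ℂ) (hd : 2 ≤ R.natDegree) {c : ℂ} (hc : c ≠ 0) {k : ℕ}
    (hph : (c * I ^ (k + 2)).re = 0) (D : Polynomial ℂ) (hD : D.natDegree ≤ R.natDegree * (k + 1))
    {μ B : ℝ} {t : ℂ} (hv : |(R.eval t).re - μ * Real.log ‖t‖| ≤ B) (h1 : 1 ≤ ‖t‖)
    (h2 : 2 * coeffNormSum R.eraseLead ≤ ‖R.leadingCoeff‖ * ‖t‖)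
    (h3 : 4 * (|μ| + |B|) ≤ ‖R.leadingCoeff‖ * ‖t‖)
    {K₀ : ℝ} (hK₀ : K₀ = ((k + 2 : ℕ) : ℝ) * ‖c‖ / 2 ^ (k + 1) * |B| +
      ‖c‖ * ((k + 2 : ℕ) : ℝ) ^ 2 * (2 / ‖R.leadingCoeff‖) * (|μ| + |B|) ^ 2 +
      coeffNormSum D * (2 / ‖R.leadingCoeff‖) ^ (k + 1))
    (h4 : 2 * K₀ ≤ ((k + 2 : ℕ) : ℝ) * ‖c‖ / 2 ^ (k + 1) * |μ| * Real.log ‖t‖) :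
    (‖R.leadingCoeff‖ / 2) ^ (k + 1) * ‖t‖ ^ (R.natDegree * (k + 1)) *
        (((k + 2 : ℕ) : ℝ) * ‖c‖ / 2 ^ (k + 1) * |μ| / 2 * Real.log ‖t‖) ≤
      |((Polynomial.C c * R ^ (k + 2) + D).eval t).re| := by
  set d : ℕ := R.natDegree with hd_def
  have hR0 : R ≠ 0 := by rintro rfl; rw [hd_def, Polynomial.natDegree_zero] at hd; omega
  obtain ⟨a, ha_def⟩ : ∃ a : ℂ, a = R.leadingCoeff := ⟨_, rfl⟩
  rw [← ha_def] at h2 h3 hK₀ ⊢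
  have ha0 : a ≠ 0 := by rw [ha_def]; exact Polynomial.leadingCoeff_ne_zero.2 hR0
  have hapos : 0 < ‖a‖ := norm_pos_iff.2 ha0
  obtain ⟨κ₁, hκ₁⟩ : ∃ κ₁ : ℝ, κ₁ = ((k + 2 : ℕ) : ℝ) * ‖c‖ / 2 ^ (k + 1) := ⟨_, rfl⟩
  rw [← hκ₁] at hK₀ h4 ⊢
  have hκ₁pos : 0 < κ₁ := by rw [hκ₁]; have := norm_pos_iff.2 hc; positivity
  obtain ⟨CD, hCD⟩ : ∃ CD : ℝ, CD = coeffNormSum D := ⟨_, rfl⟩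
  rw [← hCD] at hK₀
  have hCD0 : 0 ≤ CD := by rw [hCD]; exact coeffNormSum_nonneg _
  set s : ℝ := ‖t‖ with hs_def
  have hs0 : 0 < s := by linarith
  have hlogs0 : 0 ≤ Real.log s := Real.log_nonneg h1
  have hlogs_le : Real.log s ≤ s := (Real.log_le_sub_one_of_pos hs0).trans (by linarith)
  obtain ⟨w, hw_def⟩ : ∃ w : ℂ, w = R.eval t := ⟨_, rfl⟩
  have hGeval : (Polynomial.C c * R ^ (k + 2) + D).eval t = c * w ^ (k + 2) + D.eval t := by
    rw [Polynomial.eval_add, Polynomial.eval_mul, Polynomial.eval_C, Polynomial.eval_pow, hw_def]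
  rw [hGeval]
  -- lower bound for `‖w‖`
  have hwlow : ‖a‖ / 2 * s ^ d ≤ ‖w‖ := by
    have := norm_eval_ge_half_lead R (by omega) h1 (by rw [← ha_def]; exact h2)
    rwa [← ha_def, ← hw_def] at this
  have hsd2 : s ^ 2 ≤ s ^ d := pow_le_pow_right₀ h1 hd
  have hsd_w : s ^ d ≤ 2 / ‖a‖ * ‖w‖ := by
    rw [div_mul_eq_mul_div, le_div_iff₀ hapos]; linarith
  -- the real part `x`
  set x : ℝ := w.re with hx_def
  rw [← hw_def] at hv
  have hxup : |x| ≤ |μ| * Real.log s + |B| := by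
    have h' : |x| ≤ |μ * Real.log s| + B := by
      have := abs_sub_abs_le_abs_sub x (μ * Real.log s); linarith
    rw [abs_mul, abs_of_nonneg hlogs0] at h'
    linarith [le_abs_self B]
  have hxlow : |μ| * Real.log s - |B| ≤ |x| := by
    have h' : |μ * Real.log s| - |x| ≤ B := by
      have := abs_sub_abs_le_abs_sub (μ * Real.log s) x
      rw [abs_sub_comm] at this; linarith
    rw [abs_mul, abs_of_nonneg hlogs0] at h'
    linarith [le_abs_self B]
  have hxs : |x| ≤ (|μ| + |B|) * s := by
    calc |x| ≤ |μ| * Real.log s + |B| := hxup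
      _ ≤ |μ| * s + |B| * s := add_le_add (mul_le_mul_of_nonneg_left hlogs_le (abs_nonneg μ))
          (le_mul_of_one_le_right (abs_nonneg B) h1)
      _ = (|μ| + |B|) * s := by ring
  -- `|x| ≤ ‖w‖/2`, hence `|y| ≥ ‖w‖/2`
  have hxw : |x| ≤ ‖w‖ / 2 := by
    have hstep : (|μ| + |B|) * s ≤ ‖a‖ / 4 * s ^ 2 := by
      have : (|μ| + |B|) * s * 4 ≤ ‖a‖ * s * s := by nlinarith
      nlinarith
    calc |x| ≤ (|μ| + |B|) * s := hxs
      _ ≤ ‖a‖ / 4 * s ^ 2 := hstep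
      _ ≤ ‖a‖ / 4 * s ^ d := mul_le_mul_of_nonneg_left hsd2 (by positivity)
      _ ≤ ‖w‖ / 2 := by linarith
  set y : ℝ := w.im with hy_def
  have hylow : ‖w‖ / 2 ≤ |y| := by
    have := Complex.norm_le_abs_re_add_abs_im w
    rw [← hx_def, ← hy_def] at this; linarith
  -- the three terms
  obtain ⟨r, hr_def⟩ : ∃ r : ℝ, r = (c * I ^ (k + 1)).re := ⟨_, rfl⟩
  have hrabs : |r| = ‖c‖ := by rw [hr_def]; exact (abs_re_mul_I_pow_pred_of_phase hph).2
  have htaylor := abs_re_mul_pow_sub_taylor_le hph w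
  rw [← hx_def, ← hy_def, ← hr_def] at htaylor
  have hmain : κ₁ * ‖w‖ ^ (k + 1) * (|μ| * Real.log s - |B|) ≤
      |((k + 2 : ℕ) : ℝ) * x * y ^ (k + 1) * r| := by
    rw [abs_mul, abs_mul, abs_mul, hrabs, abs_pow, Nat.abs_cast]
    have hyk : (‖w‖ / 2) ^ (k + 1) ≤ |y| ^ (k + 1) := pow_le_pow_left₀ (by positivity) hylow _
    have hpos1 : 0 ≤ ((k + 2 : ℕ) : ℝ) * |x| := by positivity
    calc κ₁ * ‖w‖ ^ (k + 1) * (|μ| * Real.log s - |B|)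
        = (((k + 2 : ℕ) : ℝ) * (|μ| * Real.log s - |B|)) * (‖w‖ / 2) ^ (k + 1) * ‖c‖ := by
          rw [hκ₁, div_pow]; ring
      _ ≤ (((k + 2 : ℕ) : ℝ) * |x|) * (‖w‖ / 2) ^ (k + 1) * ‖c‖ := by gcongr
      _ ≤ (((k + 2 : ℕ) : ℝ) * |x|) * |y| ^ (k + 1) * ‖c‖ :=
          mul_le_mul_of_nonneg_right (mul_le_mul_of_nonneg_left hyk hpos1) (norm_nonneg c)
      _ = ((k + 2 : ℕ) : ℝ) * |x| * |y| ^ (k + 1) * ‖c‖ := by ring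
  have hjunk : ‖c‖ * ((k + 2 : ℕ) : ℝ) ^ 2 * ‖w‖ ^ k * x ^ 2 ≤
      ‖c‖ * ((k + 2 : ℕ) : ℝ) ^ 2 * (2 / ‖a‖) * (|μ| + |B|) ^ 2 * ‖w‖ ^ (k + 1) := by
    have hx2 : x ^ 2 ≤ (|μ| + |B|) ^ 2 * s ^ 2 := by
      rw [← sq_abs x, ← mul_pow]; exact pow_le_pow_left₀ (abs_nonneg x) hxs 2
    have hs2w : s ^ 2 ≤ 2 / ‖a‖ * ‖w‖ := hsd2.trans hsd_w
    have hwk : 0 ≤ ‖w‖ ^ k := pow_nonneg (norm_nonneg _) _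
    calc ‖c‖ * ((k + 2 : ℕ) : ℝ) ^ 2 * ‖w‖ ^ k * x ^ 2
        ≤ ‖c‖ * ((k + 2 : ℕ) : ℝ) ^ 2 * ‖w‖ ^ k * ((|μ| + |B|) ^ 2 * s ^ 2) := by gcongr
      _ ≤ ‖c‖ * ((k + 2 : ℕ) : ℝ) ^ 2 * ‖w‖ ^ k * ((|μ| + |B|) ^ 2 * (2 / ‖a‖ * ‖w‖)) := by gcongr
      _ = ‖c‖ * ((k + 2 : ℕ) : ℝ) ^ 2 * (2 / ‖a‖) * (|μ| + |B|) ^ 2 * ‖w‖ ^ (k + 1) := by ring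
  have hDb : |(D.eval t).re| ≤ CD * (2 / ‖a‖) ^ (k + 1) * ‖w‖ ^ (k + 1) := by
    have h0 : ‖D.eval t‖ ≤ CD * s ^ (d * (k + 1)) := by
      rw [hCD]; exact norm_eval_le_of_natDegree_le D h1 le_rfl hD
    have hpow : s ^ (d * (k + 1)) ≤ (2 / ‖a‖ * ‖w‖) ^ (k + 1) := by
      rw [pow_mul]; exact pow_le_pow_left₀ (by positivity) hsd_w _
    calc |(D.eval t).re| ≤ ‖D.eval t‖ := Complex.abs_re_le_norm _
      _ ≤ CD * s ^ (d * (k + 1)) := h0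
      _ ≤ CD * (2 / ‖a‖ * ‖w‖) ^ (k + 1) := mul_le_mul_of_nonneg_left hpow hCD0
      _ = CD * (2 / ‖a‖) ^ (k + 1) * ‖w‖ ^ (k + 1) := by rw [mul_pow]; ring
  -- assemble
  have hwk1 : 0 ≤ ‖w‖ ^ (k + 1) := pow_nonneg (norm_nonneg _) _
  have htri : |((k + 2 : ℕ) : ℝ) * x * y ^ (k + 1) * r| -
      ‖c‖ * ((k + 2 : ℕ) : ℝ) ^ 2 * ‖w‖ ^ k * x ^ 2 - |(D.eval t).re| ≤
      |(c * w ^ (k + 2) + D.eval t).re| := by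
    rw [Complex.add_re]
    have hA : |((k + 2 : ℕ) : ℝ) * x * y ^ (k + 1) * r| - |(c * w ^ (k + 2)).re -
        ((k + 2 : ℕ) : ℝ) * x * y ^ (k + 1) * r| ≤ |(c * w ^ (k + 2)).re| := by
      have := abs_add_le ((c * w ^ (k + 2)).re)
        (-((c * w ^ (k + 2)).re - ((k + 2 : ℕ) : ℝ) * x * y ^ (k + 1) * r))
      rw [show (c * w ^ (k + 2)).re + -((c * w ^ (k + 2)).re -
        ((k + 2 : ℕ) : ℝ) * x * y ^ (k + 1) * r) = ((k + 2 : ℕ) : ℝ) * x * y ^ (k + 1) * r by ring,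
        abs_neg] at this
      linarith only [this]
    have hB2 : |(c * w ^ (k + 2)).re| - |(D.eval t).re| ≤ |(c * w ^ (k + 2)).re + (D.eval t).re| := by
      have := abs_add_le ((c * w ^ (k + 2)).re + (D.eval t).re) (-(D.eval t).re)
      rw [add_neg_cancel_right, abs_neg] at this
      linarith only [this]
    linarith only [hA, hB2, htaylor]
  have hsum : ‖w‖ ^ (k + 1) * (κ₁ * |μ| * Real.log s - K₀) ≤
      |((k + 2 : ℕ) : ℝ) * x * y ^ (k + 1) * r| -
      ‖c‖ * ((k + 2 : ℕ) : ℝ) ^ 2 * ‖w‖ ^ k * x ^ 2 - |(D.eval t).re| := by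
    have e1 : ‖w‖ ^ (k + 1) * (κ₁ * |μ| * Real.log s - K₀) =
        κ₁ * ‖w‖ ^ (k + 1) * (|μ| * Real.log s - |B|) -
        ‖c‖ * ((k + 2 : ℕ) : ℝ) ^ 2 * (2 / ‖a‖) * (|μ| + |B|) ^ 2 * ‖w‖ ^ (k + 1) -
        CD * (2 / ‖a‖) ^ (k + 1) * ‖w‖ ^ (k + 1) := by rw [hK₀]; ring
    rw [e1]; exact sub_le_sub (sub_le_sub hmain hjunk) hDb
  have hhalf : ‖w‖ ^ (k + 1) * (κ₁ * |μ| / 2 * Real.log s) ≤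
      ‖w‖ ^ (k + 1) * (κ₁ * |μ| * Real.log s - K₀) :=
    mul_le_mul_of_nonneg_left (by linarith only [h4]) hwk1
  have hwk1low : (‖a‖ / 2) ^ (k + 1) * s ^ (d * (k + 1)) ≤ ‖w‖ ^ (k + 1) := by
    rw [pow_mul, ← mul_pow]; exact pow_le_pow_left₀ (by positivity) hwlow _
  have hfac : 0 ≤ κ₁ * |μ| / 2 * Real.log s := by positivity
  calc (‖a‖ / 2) ^ (k + 1) * s ^ (d * (k + 1)) * (κ₁ * |μ| / 2 * Real.log s)
      ≤ ‖w‖ ^ (k + 1) * (κ₁ * |μ| / 2 * Real.log s) := mul_le_mul_of_nonneg_right hwk1low hfac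
    _ ≤ _ := hhalf.trans (hsum.trans htri)

/-! ## Part C. Growth along a tilted edge -/

/-- **Growth along a tilted edge.**  See the module docstring. (new) -/
theorem tendsto_growth_eval_of_tilt (R : Polynomial ℂ) (hd : 2 ≤ R.natDegree) (c : ℂ) (hc : c ≠ 0)
    (e : ℕ) (he : 2 ≤ e) (hph : (c * I ^ e).re = 0) (D : Polynomial ℂ)
    (hD : D.natDegree ≤ R.natDegree * (e - 1)) {t : ℕ → ℂ}
    (ht : Tendsto (fun j => ‖t j‖) atTop atTop) {μ B : ℝ} (hμ : μ ≠ 0)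
    (hval : ∀ j, |(R.eval (t j)).re - μ * Real.log ‖t j‖| ≤ B) :
    Tendsto (fun j => |((Polynomial.C c * R ^ e + D).eval (t j)).re| /
      Real.log (2 + ‖(Polynomial.C c * R ^ e + D).eval (t j)‖)) atTop atTop := by
  obtain ⟨k, rfl⟩ : ∃ k, e = k + 2 := ⟨e - 2, by omega⟩
  have hk1 : k + 2 - 1 = k + 1 := by omega
  rw [hk1] at hD
  set d : ℕ := R.natDegree with hd_def
  obtain ⟨G, hG_def⟩ : ∃ G : Polynomial ℂ, G = Polynomial.C c * R ^ (k + 2) + D := ⟨_, rfl⟩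
  rw [← hG_def]
  have hR0 : R ≠ 0 := by rintro rfl; rw [hd_def, Polynomial.natDegree_zero] at hd; omega
  obtain ⟨a, ha_def⟩ : ∃ a : ℂ, a = R.leadingCoeff := ⟨_, rfl⟩
  have ha0 : a ≠ 0 := by rw [ha_def]; exact Polynomial.leadingCoeff_ne_zero.2 hR0
  have hapos : 0 < ‖a‖ := norm_pos_iff.2 ha0
  have hcpos : 0 < ‖c‖ := norm_pos_iff.2 hc
  have hμpos : 0 < |μ| := abs_pos.2 hμ
  obtain ⟨κ₁, hκ₁⟩ : ∃ κ₁ : ℝ, κ₁ = ((k + 2 : ℕ) : ℝ) * ‖c‖ / 2 ^ (k + 1) := ⟨_, rfl⟩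
  have hκ₁pos : 0 < κ₁ := by rw [hκ₁]; positivity
  obtain ⟨K₀, hK₀⟩ : ∃ K₀ : ℝ, K₀ = ((k + 2 : ℕ) : ℝ) * ‖c‖ / 2 ^ (k + 1) * |B| +
      ‖c‖ * ((k + 2 : ℕ) : ℝ) ^ 2 * (2 / ‖R.leadingCoeff‖) * (|μ| + |B|) ^ 2 +
      coeffNormSum D * (2 / ‖R.leadingCoeff‖) ^ (k + 1) := ⟨_, rfl⟩
  obtain ⟨N, hN⟩ : ∃ N : ℕ, N = G.natDegree + 2 := ⟨_, rfl⟩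
  have hNpos : (0 : ℝ) < (N : ℝ) := by rw [hN]; positivity
  obtain ⟨Kstar, hKstar_def⟩ : ∃ Kstar : ℝ,
    Kstar = (‖a‖ / 2) ^ (k + 1) * (κ₁ * |μ| / 2) / (2 * (N : ℝ)) := ⟨_, rfl⟩
  have hKstar : 0 < Kstar := by rw [hKstar_def]; positivity
  -- eventual conditions on `s = ‖t j‖`
  have hlog : Tendsto (fun j => Real.log ‖t j‖) atTop atTop := Real.tendsto_log_atTop.comp ht
  have hE1 : ∀ᶠ j in atTop, 1 ≤ ‖t j‖ := ht.eventually_ge_atTop 1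
  have hE2 : ∀ᶠ j in atTop, 2 * coeffNormSum R.eraseLead / ‖a‖ ≤ ‖t j‖ := ht.eventually_ge_atTop _
  have hE3 : ∀ᶠ j in atTop, 4 * (|μ| + |B|) / ‖a‖ ≤ ‖t j‖ := ht.eventually_ge_atTop _
  have hE4 : ∀ᶠ j in atTop, 2 * K₀ / (κ₁ * |μ|) ≤ Real.log ‖t j‖ := hlog.eventually_ge_atTop _
  have hE5 : ∀ᶠ j in atTop, Real.log (2 + (coeffNormSum G + 1)) ≤ Real.log ‖t j‖ :=
    hlog.eventually_ge_atTop _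
  have hE6 : ∀ᶠ j in atTop, 3 ≤ ‖t j‖ := ht.eventually_ge_atTop 3
  have hcmp : Tendsto (fun j => Kstar * ‖t j‖) atTop atTop := ht.const_mul_atTop hKstar
  refine tendsto_atTop_mono' atTop ?_ hcmp
  filter_upwards [hE1, hE2, hE3, hE4, hE5, hE6] with j h1 h2 h3 h4 h5 h6
  have h2' : 2 * coeffNormSum R.eraseLead ≤ ‖R.leadingCoeff‖ * ‖t j‖ := by
    rw [div_le_iff₀ hapos] at h2; rw [← ha_def]; linarith only [h2]
  have h3' : 4 * (|μ| + |B|) ≤ ‖R.leadingCoeff‖ * ‖t j‖ := by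
    rw [div_le_iff₀ hapos] at h3; rw [← ha_def]; linarith only [h3]
  have h4' : 2 * K₀ ≤ ((k + 2 : ℕ) : ℝ) * ‖c‖ / 2 ^ (k + 1) * |μ| * Real.log ‖t j‖ := by
    rw [div_le_iff₀ (by positivity : (0 : ℝ) < κ₁ * |μ|)] at h4; rw [← hκ₁]; linarith only [h4]
  have hlow := tilt_re_lower_bound R hd hc hph D hD (hval j) h1 h2' h3' hK₀ h4'
  rw [← ha_def, ← hG_def] at hlow
  have hlogG := log_two_add_norm_eval_le G h1 h5
  rw [← hN] at hlogG
  have hlogGpos : 0 < Real.log (2 + ‖G.eval (t j)‖) :=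
    Real.log_pos (by linarith only [norm_nonneg (G.eval (t j))])
  have hlogspos : 0 < Real.log ‖t j‖ := Real.log_pos (by linarith only [h6])
  have hsdk : ‖t j‖ ≤ ‖t j‖ ^ (d * (k + 1)) := by
    calc ‖t j‖ = ‖t j‖ ^ 1 := (pow_one _).symm
      _ ≤ ‖t j‖ ^ (d * (k + 1)) := pow_le_pow_right₀ h1 (Nat.mul_pos (by omega) (Nat.succ_pos k))
  have hlow' : (‖a‖ / 2) ^ (k + 1) * ‖t j‖ ^ (d * (k + 1)) * (κ₁ * |μ| / 2 * Real.log ‖t j‖) ≤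
      |(G.eval (t j)).re| := by rw [hκ₁]; exact hlow
  calc Kstar * ‖t j‖ ≤ Kstar * ‖t j‖ ^ (d * (k + 1)) := mul_le_mul_of_nonneg_left hsdk hKstar.le
    _ = ((‖a‖ / 2) ^ (k + 1) * ‖t j‖ ^ (d * (k + 1)) * (κ₁ * |μ| / 2 * Real.log ‖t j‖)) /
          (2 * (N : ℝ) * Real.log ‖t j‖) := by
        rw [hKstar_def]; field_simp
    _ ≤ |(G.eval (t j)).re| / (2 * (N : ℝ) * Real.log ‖t j‖) :=
        div_le_div_of_nonneg_right hlow' (by positivity)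
    _ ≤ |(G.eval (t j)).re| / Real.log (2 + ‖G.eval (t j)‖) :=
        div_le_div_of_nonneg_left (abs_nonneg _) hlogGpos hlogG

end Summit.Schanuel.Schanuel.Theorems
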